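import Summits.NavierStokesRegularity.FluidComputer.BlockQuadTransit
import Summits.NavierStokesRegularity.NavierStokesRegularity.Theorems.FluidComputerReach

/-!
# Fourier-block design — the quadratic transit gate MEETS THE REACH LAYER: a reach certificate
# with margin `1/400`; the residue re-typed as two pointwise guarded inequalities; blow-up; liveness

HONEST FRAMING: low prior, high value-of-information experiment on Tao's machine paradigm; NOT a
claim that NS blows up. §2 is finite-dimensional ODE theory about a circuit DESIGN; §1, §3 are
implications from a structure (`OpenReachBound`) typing what the Navier–Stokes equations would have
to do, which this lane presumes FALSE for the two-wavelet block design and does not claim.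

WHAT IS PROVED. (§2, design level) `quadReachCertificate`: for `η ∈ [1/2, 9/10]`, `k ≥ 6` and EVERY
defect level `ε ∈ [0, 1/400]`, the quadratic transit gate `quadVF k η (a, b) = (-kηab, ka²)` on the
open windows `AinO ⊆ {a > 29/20, |b| < 1/5}`, `AoutO = [-1/4, 1/4] × [3/2, ∞)` of `Params.reg`
INHABITS the blueprint's robust reach–avoid interface `ReachCertificate F U ε τc Ain Aout` of
`Literature/…/FluidComputer/ReachCertificate.lean`, with working region `U = loadedRegion η`
`= {W > 2}`, `W = a² + ηb²`, cycle time `1`, reach tube = the two-sided energy band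
`(1 + W p) e^{-2εσ} ≤ 1 + W ≤ (1 + W p) e^{2εσ}` (`pseudo_energy_band`; it stays loaded,
`quadTube_subset_loaded`) and REACH at `σ = 1` = `quad_pseudoOrbit_datO` (`BlockQuadTransit.lean`).
The admissible defect is a CONSTANT of the design, uniform in the input amplitude — no `e^{-Lτc}`:
the delay is produced by finite path length at speed bounded below (`ḃ = ka² ≥ 6·(29/20)²` at
entry), not by slowness — the kind of gate the honest ceiling of `ReachCertificate.lean` asks for.
HONEST: a TRANSIT gate, not an abrupt one; its output amplitude is input-dependent (the `1/√η`
drift absorbed by the OPEN windows of `BlockOpenWindow.lean`); abruptness is not part of the reach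
interface — leakage during transit is the separate idea-bound field `junk_rate`.
(§3) `OpenReachBound 𝒟 P F U ε`: the lane's RESIDUE for an open block design, RE-TYPED in the reach
layer's LOCAL GUARDED form (`ReachCircuit.defect` / `junk_rate`): a junk ceiling `jbar > jrun`, a
clock `unit n ≤ Tmax n`, and two instantaneous inequalities about every `H¹⁰_df`-mild Navier–Stokes
trajectory, claimed at every instant at which the generation-`n` readout is in `U` and the junk is
below `jbar √E_n`: (i) the block readout has a right derivative whose rescaled value is `ε`-close
to `F(readout)`; (ii) the lower right Dini derivative of the junk is at most `(jrun - jin) √E_n` per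
rescaled unit time. `toReachCircuit` assembles the statics of `BlockOpenWindow.lean` with ANY
certificate into a `ReachCircuit`; `ns_blowup_of_quadReachBound`: for `F = quadVF k η`,
`U = loadedRegion η`, `ε ≤ 1/400`, `α > 0`, the residue refutes Clay (A)
(`ns_blowup_of_reachCircuit`); liveness and THE CASCADE THEOREM
(`energy_reaches_all_scales_of_quadReachBound`) follow in the mild theory from PER-INPUT control
of the tube (§1, `reach_live_of_controlAt` — the uniform `ReachCircuit.H10Control` fails for open
windows, whose inputs are unbounded; the energy band is bounded per input). This SUPERSEDES the
whole-tick axioms `OpenIdeaBound.shadow` / `leak` for the quadratic design (the bootstrap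
`ReachCircuit.reach_sharp` derives the whole-tick tube and leakage bounds from (i)–(ii)).

HONEST READING. The value is in the TYPING: the residue of the block line is now the sharpest this
lane has produced — a refutation needs ONE instant of ONE trajectory, read in the loaded region
with junk below the ceiling, at which (i) or (ii) fails — and the soft part from it to blow-up is
kernel-checked through the blueprint's reach layer with an order-one defect tolerance. Whether (i)
can hold is the untouched analytic question (β1)/(β2b) of `ASSEMBLY.md` (the pair coefficients of
the true wavelet triad would have to realise `quadVF`, every other coupling plus junk feedback
staying below `1/400` in rescaled units at every loaded amplitude); presumed FALSE, not computed.
-/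

noncomputable section

open MeasureTheory Set Filter Topology Metric
open scoped ENNReal NNReal SchwartzMap

namespace Summit.NavierStokesRegularity.FluidComputer

open Literature.Analysis.FluidPDE Literature.Analysis.FluidPDE.Tao2016
open Literature.Analysis.FluidPDE.FluidComputer
open Literature.Analysis.FunctionSpaces (eFourierSobolevNorm)
open Summit.NavierStokesRegularity.NavierStokesRegularity.Theorems.FluidComputer

/-! ## §1. Architecture: liveness of a reach design from PER-INPUT control of its tube -/

section Live

variable {S : CascadeSpecs} {O : Type*} [NormedAddCommGroup O] [NormedSpace ℝ O] {s : ℝ}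
  (R : ReachCircuit S O s)

/-- **Per-input `H¹⁰` control of the reach tube**: for every generation `n` and every input readout
`p ∈ Ain` separately, one bound on the `H¹⁰` norm of the `H¹⁰_df` states read in `Tube p σ`,
`σ ∈ [0, τc]`, with junk below the running threshold. Weaker than `ReachCircuit.H10Control` (one
bound per generation), which FAILS for open windows; it is what liveness consumes. [folklore] -/
def ReachControlAt : Prop :=
  ∀ n : ℕ, ∀ p ∈ R.Ain, ∃ M : ℝ, ∀ v : L2C, MemH10df v →
    (∃ σ ∈ Icc 0 R.τc, R.read n v ∈ R.Tube p σ) →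
      R.junk n v ≤ ENNReal.ofReal (R.jrun * Real.sqrt (S.Emin n)) →
        eFourierSobolevNorm 10 v ≤ ENNReal.ofReal M

/-- **Liveness from per-input control** (the proof of `ReachCircuit.live`, choosing the bound after
the input readout `read n v`): a loaded `H¹⁰_df` state all of whose trajectories die within the tick
has a maximal trajectory with unbounded `H¹⁰` norm, which `reach_sharp` keeps in the reach tube of
`read n v` with running junk — an `H¹⁰`-bounded set. [cite: Tao2016AveragedNS, §6 Prop. 6.3] -/
theorem reach_live_of_controlAt (hth : H10MildTheory) (hctrl : ReachControlAt R) :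
    R.toPumpCascade.Live := by
  intro n v hv h10
  by_contra hne
  push Not at hne
  have hle : ∀ (S' : ℝ) (u : ℝ → L2C), IsMildSolutionFor eulerForm v (Ico 0 S') u →
      S' ≤ R.unit n * R.τc := by
    intro S' u hu
    by_contra h
    exact hne S' (lt_of_not_ge h) u hu
  have hvIn : v ∈ R.In n := hv
  obtain ⟨M, hM⟩ := hctrl n (R.read n v) hvIn.1
  obtain ⟨Sm, hSm, hSmT, U, hU, -, hunb⟩ := exists_maximal_unbounded_of_lifespan_le hth h10 hle
  obtain ⟨t', ht', hlt⟩ := hunb M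
  have h0 : U 0 = v := initial_eq hU ⟨le_rfl, hSm⟩ h10
  have hv' : U 0 ∈ R.In n := by rw [h0]; exact hv
  have hne0 : R.unit n ≠ 0 := (R.unit_pos n).ne'
  set σ : ℝ := t' / R.unit n with hσdef
  have hσ0 : 0 ≤ σ := div_nonneg ht'.1 (R.unit_pos n).le
  have hσeq : R.unit n * σ = t' := by rw [mul_comm]; exact div_mul_cancel₀ t' hne0
  have hστ : σ ≤ R.τc := by
    have h1 : R.unit n * σ ≤ R.unit n * R.τc := by rw [hσeq]; exact ht'.2.le.trans hSmT
    exact le_of_mul_le_mul_left h1 (R.unit_pos n)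
  have hlt' : 0 + R.unit n * σ < Sm := by rw [zero_add, hσeq]; exact ht'.2
  have h := R.reach_sharp n v Sm U hU 0 le_rfl hv'.1 hv'.2 σ hσ0 hστ hlt'
  rw [zero_add, hσeq, h0] at h
  have hbd := hM (U t') (hU.1 t' ht') ⟨σ, ⟨hσ0, hστ⟩, h.1⟩
    (h.2.trans (ENNReal.ofReal_le_ofReal
      (mul_le_mul_of_nonneg_right (R.jin_add_mul_le hστ) (Real.sqrt_nonneg _))))
  exact absurd hlt (not_lt.2 hbd)

end Live

namespace BlockDesign

variable {𝒟 : CascadeWaveletData 1 1} {S : CascadeSpecs} {P : Params S}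

/-! ## §2. The quadratic transit gate inhabits the reach-certificate interface (design level) -/

/-- **The reach tube of the quadratic transit design** at defect level `ε`: the two-sided
exponential energy band `(1 + W p) e^{-2εσ} ≤ 1 + W z ≤ (1 + W p) e^{2εσ}`, `W = a² + η b²`, about
the input readout `p` after rescaled time `σ` (`pseudo_energy_band`). [folklore] -/
def quadTube (η ε : ℝ) (p : ℝ × ℝ) (σ : ℝ) : Set (ℝ × ℝ) :=
  {z | (1 + pairEnergy η p) * Real.exp (-(2 * ε) * σ) ≤ 1 + pairEnergy η z ∧
    1 + pairEnergy η z ≤ (1 + pairEnergy η p) * Real.exp (2 * ε * σ)}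

/-- The tube starts at the input readout. [folklore] -/
theorem mem_quadTube_zero (η ε : ℝ) (p : ℝ × ℝ) : p ∈ quadTube η ε p 0 := by
  simp only [quadTube, Set.mem_setOf_eq, mul_zero, Real.exp_zero, mul_one, le_refl, and_self]

/-- The tube has closed graph over any time interval `[0, τc]`. [folklore] -/
theorem quadTube_closed (η ε : ℝ) (p : ℝ × ℝ) (τc : ℝ) :
    IsClosed {z : ℝ × (ℝ × ℝ) | z.1 ∈ Icc 0 τc ∧ z.2 ∈ quadTube η ε p z.1} := by
  have hW : Continuous fun z : ℝ × (ℝ × ℝ) => 1 + pairEnergy η z.2 := by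
    unfold pairEnergy
    exact continuous_const.add (((continuous_fst.comp continuous_snd).pow 2).add
      (continuous_const.mul ((continuous_snd.comp continuous_snd).pow 2)))
  have he : ∀ c : ℝ, Continuous fun z : ℝ × (ℝ × ℝ) => (1 + pairEnergy η p) * Real.exp (c * z.1) :=
    fun c => continuous_const.mul (Real.continuous_exp.comp (continuous_const.mul continuous_fst))
  exact (isClosed_Icc.preimage continuous_fst).inter
    ((isClosed_le (he _) hW).inter (isClosed_le hW (he _)))

/-- **The loaded region** of the observable plane: pair energy `W = a² + η b²` above `2` (units of
`E_n`) — the working region on which the re-typed residue is claimed. [folklore] -/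
def loadedRegion (η : ℝ) : Set (ℝ × ℝ) :=
  {z | 2 < pairEnergy η z}

/-- The loaded region is open. [folklore] -/
theorem isOpen_loadedRegion (η : ℝ) : IsOpen (loadedRegion η) :=
  isOpen_lt continuous_const (by
    unfold pairEnergy
    exact (continuous_fst.pow 2).add (continuous_const.mul (continuous_snd.pow 2)))

/-- **Tubes from admissible inputs stay loaded**: `p ∈ AinO (Params.reg)` (`a > 29/20`),
`σ ∈ [0, 1]`, `0 ≤ ε ≤ 1/400` ⇒ `quadTube η ε p σ ⊆ loadedRegion η`
(`(1 + W p) e^{-2εσ} > (1241/400)(199/200) > 3`). [folklore] -/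
theorem quadTube_subset_loaded (hS : S.lam0 = 1) (hη : 1 / 2 ≤ S.eta) {ε : ℝ} (hε0 : 0 ≤ ε)
    (hε : ε ≤ 1 / 400) {p : ℝ × ℝ} (hp : p ∈ AinO (Params.reg S hS hη)) {σ : ℝ}
    (hσ : σ ∈ Icc (0 : ℝ) 1) : quadTube S.eta ε p σ ⊆ loadedRegion S.eta := by
  intro z hz
  obtain ⟨ha0, -⟩ := AinO_bounds hp
  change (3 : ℝ) / 2 - 1 / 20 < p.1 at ha0
  have hWp : (841 : ℝ) / 400 < pairEnergy S.eta p := by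
    show (841 : ℝ) / 400 < p.1 ^ 2 + S.eta * p.2 ^ 2
    nlinarith [mul_nonneg S.eta_pos.le (sq_nonneg p.2)]
  have hεσ : ε * σ ≤ ε := mul_le_of_le_one_right hε0 hσ.2
  have hexp : (199 : ℝ) / 200 ≤ Real.exp (-(2 * ε) * σ) := by
    have := Real.add_one_le_exp (-(2 * ε) * σ)
    nlinarith
  have hprod := mul_le_mul_of_nonneg_left hexp (by linarith : (0 : ℝ) ≤ 1 + pairEnergy S.eta p)
  have hlo := hz.1
  show 2 < pairEnergy S.eta z
  nlinarith

/-- **Readouts in the tube are bounded per input**: `z ∈ quadTube η ε p σ`, `σ ≤ 1`, `ε ≥ 0`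
⇒ `‖z‖ ≤ √B + √(B/η)`, `B = (1 + W p) e^{2ε}` (sup norm on `ℝ × ℝ`). [folklore] -/
theorem norm_le_of_mem_quadTube {η : ℝ} (hη : 0 < η) {ε : ℝ} (hε : 0 ≤ ε) (p : ℝ × ℝ) {σ : ℝ}
    (hσ1 : σ ≤ 1) {z : ℝ × ℝ} (hz : z ∈ quadTube η ε p σ) :
    ‖z‖ ≤ Real.sqrt ((1 + pairEnergy η p) * Real.exp (2 * ε)) +
      Real.sqrt ((1 + pairEnergy η p) * Real.exp (2 * ε) / η) := by
  have hWp : 0 ≤ 1 + pairEnergy η p := by unfold pairEnergy; positivity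
  have h1 : 1 + pairEnergy η z ≤ (1 + pairEnergy η p) * Real.exp (2 * ε) :=
    hz.2.trans (mul_le_mul_of_nonneg_left
      (Real.exp_le_exp.2 (by nlinarith [mul_nonneg hε (sub_nonneg.2 hσ1)])) hWp)
  have h1' : 1 + (z.1 ^ 2 + η * z.2 ^ 2) ≤ (1 + pairEnergy η p) * Real.exp (2 * ε) := h1
  have ha : z.1 ^ 2 ≤ (1 + pairEnergy η p) * Real.exp (2 * ε) := by
    nlinarith [mul_nonneg hη.le (sq_nonneg z.2)]
  have hb : z.2 ^ 2 ≤ (1 + pairEnergy η p) * Real.exp (2 * ε) / η := by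
    rw [le_div_iff₀ hη]; nlinarith [sq_nonneg z.1]
  have ha' : |z.1| ≤ Real.sqrt ((1 + pairEnergy η p) * Real.exp (2 * ε)) := by
    rw [← Real.sqrt_sq_eq_abs]; exact Real.sqrt_le_sqrt ha
  have hb' : |z.2| ≤ Real.sqrt ((1 + pairEnergy η p) * Real.exp (2 * ε) / η) := by
    rw [← Real.sqrt_sq_eq_abs]; exact Real.sqrt_le_sqrt hb
  rw [Prod.norm_def, Real.norm_eq_abs, Real.norm_eq_abs]
  exact max_le (ha'.trans (le_add_of_nonneg_right (Real.sqrt_nonneg _)))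
    (hb'.trans (le_add_of_nonneg_left (Real.sqrt_nonneg _)))

/-- **THE QUADRATIC TRANSIT GATE MEETS THE REACH INTERFACE** (`η ∈ [1/2, 9/10]`, `k ≥ 6`,
`0 ≤ ε ≤ 1/400`): a robust reach–avoid certificate for `quadVF k η` on the loaded region at
defect `ε`, cycle time `1`, from `AinO` to `AoutO` of `Params.reg` — tube = the energy band
(`pseudo_energy_band`, `quadTube_subset_loaded`), REACH = `quad_pseudoOrbit_datO`. Design level;
the margin `1/400` is amplitude-uniform. [folklore] -/
def quadReachCertificate (hS : S.lam0 = 1) (hη : 1 / 2 ≤ S.eta) (hη2 : S.eta ≤ 9 / 10) {k : ℝ}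
    (hk : 6 ≤ k) {ε : ℝ} (hε0 : 0 ≤ ε) (hε : ε ≤ 1 / 400) :
    ReachCertificate (quadVF k S.eta) (loadedRegion S.eta) ε 1 (AinO (Params.reg S hS hη))
      (AoutO (Params.reg S hS hη)) where
  Tube := quadTube S.eta ε
  Tube_closed := fun p _ => quadTube_closed S.eta ε p 1
  Tube_zero := fun p _ => mem_quadTube_zero S.eta ε p
  Tube_sub := fun _ hp _ hσ => quadTube_subset_loaded hS hη hε0 hε hp hσ
  cert := by
    intro p hp σT x hσT0 hσT1 hx0 hcont _ hW
    classical
    -- a measurable-free velocity selection: the certificate only needs SOME right derivative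
    let w : ℝ → ℝ × ℝ := fun σ => if h : σ ∈ Ico 0 σT then (hW σ h).choose else 0
    have hderiv : ∀ σ ∈ Ico 0 σT, HasDerivWithinAt x (w σ) (Ici σ) σ := fun σ hσ => by
      simp only [w, dif_pos hσ]; exact (hW σ hσ).choose_spec.1
    have hdef : ∀ σ ∈ Ico 0 σT, ‖w σ - quadVF k S.eta (x σ)‖ ≤ ε := fun σ hσ => by
      simp only [w, dif_pos hσ]; exact (hW σ hσ).choose_spec.2
    have hη0 : 0 ≤ S.eta := S.eta_pos.le
    have hη1 : S.eta ≤ 1 := by linarith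
    refine ⟨?_, fun h1 => ?_⟩
    · have hb := pseudo_energy_band hη0 hη1 k hcont hderiv hdef σT ⟨hσT0, le_rfl⟩
      rw [hx0] at hb
      exact hb
    · subst h1
      have h0 : x 0 ∈ AinO (Params.reg S hS hη) := by rw [hx0]; exact hp
      exact ⟨1, ⟨zero_le_one, le_rfl⟩, quad_pseudoOrbit_datO hS hη hη2 hk hε hcont hderiv hdef h0⟩

/-! ## §3. The residue re-typed in the reach layer's guarded local form; blow-up; liveness -/

variable (𝒟 P) in
/-- **THE RESIDUE of an open block design with design field `F` and working region `U`, in LOCAL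
GUARDED form** (idea-bound; presumed FALSE for the two-wavelet design; typed, never claimed): a junk
ceiling `jbar > jrun`, a clock, and two instantaneous inequalities about every `H¹⁰_df`-mild
Navier–Stokes trajectory, GUARDED by `readout ∈ U` and `junk < jbar √E_n` — (i) READOUT DEFECT: the
block readout has a right derivative whose rescaled value is `ε`-close to `F`; (ii) JUNK RATE: the
lower right Dini derivative of the junk is at most `(jrun - jin) √E_n` per rescaled unit time.
These are the `defect` / `junk_rate` fields of `ReachCircuit` with `τc = 1`, `γ = jrun - jin`.
[folklore] -/
structure OpenReachBound (F : ℝ × ℝ → ℝ × ℝ) (U : Set (ℝ × ℝ)) (ε : ℝ) where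
  /-- the junk CEILING of the working region (relative, in units of `√E_n`), above running junk -/
  jbar : ℝ
  jrun_lt_jbar : P.jrun < jbar
  /-- CLOCK: physical time per unit rescaled time at generation `n` -/
  unit : ℕ → ℝ
  unit_pos : ∀ n, 0 < unit n
  /-- one tick (rescaled cycle time `1`) fits in the spec's firing allowance -/
  clock : ∀ n, unit n ≤ S.Tmax n
  /-- DYNAMICS (idea-bound, instantaneous, guarded): READOUT DEFECT -/
  defect : ∀ (n : ℕ) (a : L2C) (S' : ℝ) (u : ℝ → L2C), IsMildSolutionFor eulerForm a (Ico 0 S') u →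
    ∀ t : ℝ, 0 ≤ t → t < S' → read 𝒟 S n (u t) ∈ U →
      junk 𝒟 P n (u t) < ENNReal.ofReal (jbar * Real.sqrt (S.Emin n)) →
        ∃ W : ℝ × ℝ, HasDerivWithinAt (fun t' => read 𝒟 S n (u t')) W (Ici t) t ∧
          ‖unit n • W - F (read 𝒟 S n (u t))‖ ≤ ε
  /-- DYNAMICS (idea-bound, instantaneous, guarded): JUNK RATE -/
  junk_rate : ∀ (n : ℕ) (a : L2C) (S' : ℝ) (u : ℝ → L2C),
    IsMildSolutionFor eulerForm a (Ico 0 S') u →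
      ∀ t : ℝ, 0 ≤ t → t < S' → read 𝒟 S n (u t) ∈ U →
        junk 𝒟 P n (u t) < ENNReal.ofReal (jbar * Real.sqrt (S.Emin n)) →
          ∀ ρ : ℝ, P.jrun - P.jin < ρ → ∃ᶠ t' in 𝓝[>] t,
            junk 𝒟 P n (u t') ≤ junk 𝒟 P n (u t) +
              ENNReal.ofReal (ρ * Real.sqrt (S.Emin n) * ((t' - t) / unit n))

/-- **The open block design assembled in the REACH layer**: the statics of `BlockOpenWindow.lean`,
the residue `OpenReachBound 𝒟 P F U ε`, and ANY robust reach–avoid certificate for `F` on the open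
working region `U` at defect `ε`, cycle time `1`, from `AinO P` to `AoutO P`, form a `ReachCircuit`
(`s ≤ 10`). [folklore] -/
def OpenReachBound.toReachCircuit {F : ℝ × ℝ → ℝ × ℝ} {U : Set (ℝ × ℝ)} {ε : ℝ}
    (H : OpenReachBound 𝒟 P F U ε) (hs : P.s ≤ 10) (hU : IsOpen U) (hε0 : 0 ≤ ε)
    (c : ReachCertificate F U ε 1 (AinO P) (AoutO P)) : ReachCircuit S (ℝ × ℝ) P.s where
  read := read 𝒟 S
  recon := recon 𝒟 S
  junk := junk 𝒟 P
  Λ := (Real.sqrt S.eta)⁻¹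
  Λ_pos := inv_pos.2 (Real.sqrt_pos.2 S.eta_pos)
  read_lip := fun n v w => read_lip n v w
  junk_perturb := fun n v w => junk_perturb n v w
  s_le_ten := hs
  read_recon := fun n p => read_recon n p
  junk_recon := fun n p => junk_recon n p
  Ain := AinO P
  Acore := AcoreO P
  Aout := AoutO P
  δ := P.δ
  δ_pos := P.δ_pos
  core_thick := fun p hp => core_thickO p hp
  jcore := P.jcore
  jin := P.jin
  jrun := P.jrun
  jbar := H.jbar
  jcore_nonneg := P.jcore_nonneg
  jcore_lt := P.jcore_lt_jin
  jrun_lt_jbar := H.jrun_lt_jbar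
  handoff := fun n v hv hj => handoffO n v hv hj
  floor_cert := fun n v hv _ => floor_certO n v hv
  F := F
  U := U
  U_open := hU
  τc := 1
  τc_nonneg := zero_le_one
  ε := ε
  ε_nonneg := hε0
  Tube := c.Tube
  Tube_closed := c.Tube_closed
  Tube_zero := c.Tube_zero
  Tube_sub := c.Tube_sub
  cert := c.cert
  γ := P.jrun - P.jin
  γ_nonneg := sub_nonneg.2 P.jin_le_jrun
  jrun_ge := by rw [mul_one]; linarith
  unit := H.unit
  unit_pos := H.unit_pos
  clock := fun n => by rw [mul_one]; exact H.clock n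
  defect := H.defect
  junk_rate := H.junk_rate
  u₀ := seed 𝒟 P
  divFree := seed_divFree 𝒟 P
  memH10df := seed_memH10df 𝒟 P
  seed_read := seed_readO 𝒟 P
  seed_junk := seed_junk 𝒟 P

/-- **The quadratic transit design with its re-typed residue, as a reach circuit** (`Params.reg`,
`η ∈ [1/2, 9/10]`, `k ≥ 6`, `0 ≤ ε ≤ 1/400`): certificate `quadReachCertificate`. [folklore] -/
def OpenReachBound.quadCircuit (hS : S.lam0 = 1) (hη : 1 / 2 ≤ S.eta) (hη2 : S.eta ≤ 9 / 10)
    {k : ℝ} (hk : 6 ≤ k) {ε : ℝ} (hε0 : 0 ≤ ε) (hε : ε ≤ 1 / 400)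
    (H : OpenReachBound 𝒟 (Params.reg S hS hη) (quadVF k S.eta) (loadedRegion S.eta) ε) :
    ReachCircuit S (ℝ × ℝ) (Params.reg S hS hη).s :=
  H.toReachCircuit le_rfl (isOpen_loadedRegion _) hε0 (quadReachCertificate hS hη hη2 hk hε0 hε)

/-- **THE RE-TYPED RESIDUE OF THE QUADRATIC TRANSIT DESIGN REFUTES CLAY (A)** (`Params.reg`,
`η ∈ [1/2, 9/10]`, `k ≥ 6`, `0 ≤ ε ≤ 1/400`, `α > 0`): a junk ceiling, a clock and two guarded
instantaneous inequalities (readout right-derivative `ε`-close to `quadVF k η` after rescaling, on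
loaded states; junk Dini rate) imply finite-time blow-up — the certificate is a theorem.
HONEST FRAMING: the hypothesis is presumed FALSE for the two-wavelet design; NOT a claim that NS
blows up. -/
theorem ns_blowup_of_quadReachBound (hS : S.lam0 = 1) (hη : 1 / 2 ≤ S.eta) (hη2 : S.eta ≤ 9 / 10)
    {k : ℝ} (hk : 6 ≤ k) {ε : ℝ} (hε0 : 0 ≤ ε) (hε : ε ≤ 1 / 400)
    (H : OpenReachBound 𝒟 (Params.reg S hS hη) (quadVF k S.eta) (loadedRegion S.eta) ε)
    (hα : 0 < S.alpha) : ¬ NavierStokesRegularity :=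
  ns_blowup_of_reachCircuit (H.quadCircuit hS hη hη2 hk hε0 hε) hα (by linarith)

/-- **The quadratic transit design has per-input control** (`Params.reg`: `s = 10`, `μ = 1`): the
energy band from `p` is bounded (`norm_le_of_mem_quadTube`), and `h10Bound_of_read_le` bounds the
`H¹⁰` norm of states with bounded readout and running junk. [folklore] -/
theorem reachControlAt_quad (hS : S.lam0 = 1) (hη : 1 / 2 ≤ S.eta) (hη2 : S.eta ≤ 9 / 10)
    {k : ℝ} (hk : 6 ≤ k) {ε : ℝ} (hε0 : 0 ≤ ε) (hε : ε ≤ 1 / 400)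
    (H : OpenReachBound 𝒟 (Params.reg S hS hη) (quadVF k S.eta) (loadedRegion S.eta) ε) :
    ReachControlAt (H.quadCircuit hS hη hη2 hk hε0 hε) := by
  intro n p _
  obtain ⟨M, hM⟩ := h10Bound_of_read_le (𝒟 := 𝒟) (P := Params.reg S hS hη) le_rfl one_pos n
    (R' := Real.sqrt ((1 + pairEnergy S.eta p) * Real.exp (2 * ε)) +
      Real.sqrt ((1 + pairEnergy S.eta p) * Real.exp (2 * ε) / S.eta))
    (add_nonneg (Real.sqrt_nonneg _) (Real.sqrt_nonneg _))
  refine ⟨M, fun v _ htube hj => hM v ?_ hj⟩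
  obtain ⟨σ, hσ, hz⟩ := htube
  exact norm_le_of_mem_quadTube S.eta_pos hε0 p hσ.2 hz

/-- **THE QUADRATIC TRANSIT DESIGN IS LIVE GIVEN ITS RE-TYPED RESIDUE** — a theorem of the mild
`H¹⁰` theory (`h10MildTheory_holds`). [folklore] -/
theorem live_of_quadReachBound (hS : S.lam0 = 1) (hη : 1 / 2 ≤ S.eta) (hη2 : S.eta ≤ 9 / 10)
    {k : ℝ} (hk : 6 ≤ k) {ε : ℝ} (hε0 : 0 ≤ ε) (hε : ε ≤ 1 / 400)
    (H : OpenReachBound 𝒟 (Params.reg S hS hη) (quadVF k S.eta) (loadedRegion S.eta) ε) :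
    (H.quadCircuit hS hη hη2 hk hε0 hε).toPumpCascade.Live :=
  reach_live_of_controlAt _ h10MildTheory_holds (reachControlAt_quad hS hη hη2 hk hε0 hε H)

/-- **THE CASCADE THEOREM for the quadratic transit design** (`α > 0`, `η ∈ [1/2, 9/10]`, `k ≥ 6`,
`0 ≤ ε ≤ 1/400`), given the re-typed residue: along the seed's maximal `H¹⁰_df`-mild trajectory the
spec's energy `E_n` is present at frequency `≥ 2ⁿ λ₀` at clocked instants
`t_n ≤ ∑_{k<n} Tmax k < S_m ≤ T_*` for EVERY `n`, and the `H¹⁰` norm is unbounded on `[0, S_m)`.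
HONEST FRAMING: an implication from a structure presumed FALSE; NOT a claim that NS blows up. -/
theorem energy_reaches_all_scales_of_quadReachBound (hS : S.lam0 = 1) (hη : 1 / 2 ≤ S.eta)
    (hη2 : S.eta ≤ 9 / 10) {k : ℝ} (hk : 6 ≤ k) {ε : ℝ} (hε0 : 0 ≤ ε) (hε : ε ≤ 1 / 400)
    (H : OpenReachBound 𝒟 (Params.reg S hS hη) (quadVF k S.eta) (loadedRegion S.eta) ε)
    (hα : 0 < S.alpha) :
    ∃ Sm : ℝ, 0 < Sm ∧ Sm ≤ S.Tstar ∧ ∃ U : ℝ → L2C,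
      IsMildSolutionFor eulerForm (schwartzL2 (seed 𝒟 (Params.reg S hS hη))) (Ico 0 Sm) U ∧
      (∀ C : ℝ, ∃ s ∈ Ico 0 Sm, ENNReal.ofReal C < eFourierSobolevNorm 10 (U s)) ∧
      ∃ t : ℕ → ℝ, t 0 = 0 ∧ Monotone t ∧
        ∀ n, t n < Sm ∧ t n ≤ ∑ k ∈ Finset.range n, S.Tmax k ∧
          ENNReal.ofReal (S.Emin n) ≤ highFreqEnergy (S.lam n) (U (t n)) :=
  energy_reaches_all_scales (H.quadCircuit hS hη hη2 hk hε0 hε).toPumpCascade hα (by linarith)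
    (live_of_quadReachBound hS hη hη2 hk hε0 hε H)

end BlockDesign

end Summit.NavierStokesRegularity.FluidComputer

end
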